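import Mathlib.Analysis.Calculus.FDeriv.ContinuousAlternatingMap
import Mathlib.Analysis.Calculus.FDeriv.Symmetric
import Mathlib.Analysis.Calculus.ContDiff.Basic
import Mathlib.Analysis.Calculus.Deriv.Prod
import Mathlib.Analysis.Calculus.Deriv.Mul
import HarnessLib

/-!
# The origami Moser argument, I: `d/ds (ψ_s^* ω_s) = 0` along the flow, in coordinates

First file of the proof of the named fact `Literature.Geometry.Symplectic.exists_origamiCollarNormalForm`
(Cannas da Silva–Guillemin–Woodward, *On the unfolding of folded symplectic structures*, Math. Res.
Lett. 7 (2000), Thm. 1: the fold of an origami form has a collar on which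
`ω = p^*i^*ω + d(t² p^*α)`), by the Moser argument of its printed proof (McDuff–Salamon 2017,
§3.2): for the segment `ω_s = ω₀ + s dμ` one integrates the vector field `X_s` with
`ι(X_s) ω_s = -μ`; then `d/ds (ψ_s^* ω_s) = ψ_s^*(dμ + ℒ_{X_s} ω_s) = ψ_s^* d(μ + ι(X_s) ω_s) = 0`.

This file is the **coordinate form of that computation, evaluated on a pair of tangent vectors**,
as pure calculus on `ℝ × V` (time × model space `V`, any real normed space) — the pattern of
`GrayStabilityCalculus.lean` (the same computation for `1`-forms) one degree up: for a family of
`2`-forms `A (s, q)` (the chart representative of `ω_s`), a family of `1`-forms `Mu (s, q)` (that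
of `μ`), a time-dependent vector field `X (s, q)` and a map `Q (s, p)` (the flow read in charts)
with `∂_s Q = X(s, Q)`, the pairing
`f(s) = A(s, Q(s, p₀)) [∂_p Q(s, p₀) v, ∂_p Q(s, p₀) w]` — i.e. `(ψ_s^* ω_s)_{p₀}(v, w)` — has
`f'(s₀) = 0` (`hasDerivAt_trackPairing₂`), provided, at and near the relevant points:
`A(X, ·) = -Mu` (the Moser equation), `∂_s A = d Mu`, and `dA = 0` (all written with Fréchet
derivatives in Mathlib's normalisation of `extDeriv`).  The ingredients are the chain rule, the
symmetry of second derivatives of `Q` (variational equation `∂_s ∂_p Q = ∂_q X ∘ ∂_p Q`) and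
the Leibniz rule for `A(X, u) = -Mu(u)`; Cartan's formula is thereby circumvented.

Everything here is proved; no definitions beyond the pairing; no facts.

## References

* A. Cannas da Silva, V. Guillemin, C. Woodward, *On the unfolding of folded symplectic
  structures*, Math. Res. Lett. 7 (2000) 35–53, proof of Thm. 1. [CannasGuilleminWoodward2000]
* D. McDuff, D. Salamon, *Introduction to Symplectic Topology*, 3rd ed. (2017), §3.2 (Moser
  isotopy). [McDuffSalamon2017]
-/

noncomputable section

open scoped Topology
open Set Function Filter

namespace Literature.Geometry.Symplectic

namespace OrigamiMoser

variable {V : Type*} [NormedAddCommGroup V] [NormedSpace ℝ V]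

/-! ### Small vector identities -/

/-- Updating the first entry of a pair. [folklore] -/
theorem update_vec2_zero {V : Type*} (x y z : V) : Function.update ![x, y] 0 z = ![z, y] := by
  funext i; fin_cases i <;> rfl

/-- Updating the second entry of a pair. [folklore] -/
theorem update_vec2_one {V : Type*} (x y z : V) : Function.update ![x, y] 1 z = ![x, z] := by
  funext i; fin_cases i <;> rfl

/-- Swapping the arguments of a real `2`-form changes the sign. [folklore] -/
theorem alt2_swap {V : Type*} [NormedAddCommGroup V] [NormedSpace ℝ V] (C : V [⋀^Fin 2]→L[ℝ] ℝ)
    (x y : V) : C ![y, x] = -C ![x, y] := by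
  have h := C.map_swap ![x, y] (i := 0) (j := 1) (by decide)
  have hsw : (![x, y] : Fin 2 → V) ∘ Equiv.swap (0 : Fin 2) 1 = ![y, x] := by
    funext i; fin_cases i <;> rfl
  rw [hsw] at h
  exact h

/-- `![g 0 z, g 1 z]` as a function of the index. [folklore] -/
theorem vec2_eq_fun {V W : Type*} (a b : W → V) (z : W) :
    (![a z, b z] : Fin 2 → V) = fun i => (![a, b] : Fin 2 → W → V) i z := by
  funext i; fin_cases i <;> rfl

/-! ### The derivative of an evaluated family of `2`-forms -/

/-- **Derivative of `z ↦ A z [a z, b z]`** in the direction `d`: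
`(D A · d)[a, b] + A[D a · d, b] + A[a, D b · d]`. [folklore] -/
theorem fderiv_apply_vec2 {W : Type*} [NormedAddCommGroup W] [NormedSpace ℝ W]
    {A : W → V [⋀^Fin 2]→L[ℝ] ℝ} {a b : W → V} {z : W}
    (hA : DifferentiableAt ℝ A z) (ha : DifferentiableAt ℝ a z) (hb : DifferentiableAt ℝ b z) (d : W) :
    fderiv ℝ (fun z => A z ![a z, b z]) z d =
      fderiv ℝ A z d ![a z, b z] + A z ![fderiv ℝ a z d, b z] + A z ![a z, fderiv ℝ b z d] := by
  have h := fderiv_continuousAlternatingMap_apply_apply (g := ![a, b]) hA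
    (fun i => by fin_cases i <;> assumption) d
  have e1 : (fun z => A z fun i => (![a, b] : Fin 2 → W → V) i z) = fun z => A z ![a z, b z] := by
    funext z; rw [← vec2_eq_fun]
  rw [e1] at h
  have e2 : Function.update (fun i => (![a, b] : Fin 2 → W → V) i z) 0 (fderiv ℝ (![a, b] 0) z d) =
      ![fderiv ℝ a z d, b z] := by
    rw [← vec2_eq_fun]; exact update_vec2_zero _ _ _
  have e3 : Function.update (fun i => (![a, b] : Fin 2 → W → V) i z) 1 (fderiv ℝ (![a, b] 1) z d) =
      ![a z, fderiv ℝ b z d] := by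
    rw [← vec2_eq_fun]; exact update_vec2_one _ _ _
  rw [h, Fin.sum_univ_two, e2, e3, ← vec2_eq_fun, add_assoc]

/-- **Leibniz rule for the Moser equation `A(X, u) = -Mu(u)`**: differentiating in the direction
`d` at `z₀`, `(D A · d)[X, u] + A[D X · d, u] = -(D Mu · d)[u]`. [folklore] -/
theorem fderiv_moser_eq {A : ℝ × V → V [⋀^Fin 2]→L[ℝ] ℝ} {Mu : ℝ × V → V [⋀^Fin 1]→L[ℝ] ℝ}
    {X : ℝ × V → V} {z₀ : ℝ × V}
    (hA : DifferentiableAt ℝ A z₀) (hMu : DifferentiableAt ℝ Mu z₀) (hX : DifferentiableAt ℝ X z₀)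
    (h0 : ∀ᶠ z in 𝓝 z₀, ∀ u, A z ![X z, u] = -Mu z ![u]) (d : ℝ × V) (u : V) :
    fderiv ℝ A z₀ d ![X z₀, u] + A z₀ ![fderiv ℝ X z₀ d, u] = -(fderiv ℝ Mu z₀ d ![u]) := by
  have hev : (fun z => A z ![X z, u]) =ᶠ[𝓝 z₀] fun z => -Mu z ![u] := by
    filter_upwards [h0] with z hz
    exact hz u
  have h1 : fderiv ℝ (fun z => A z ![X z, u]) z₀ d =
      fderiv ℝ A z₀ d ![X z₀, u] + A z₀ ![fderiv ℝ X z₀ d, u] := by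
    have hz : fderiv ℝ (fun _ : ℝ × V => u) z₀ d = 0 := by
      rw [fderiv_const_apply]; rfl
    rw [fderiv_apply_vec2 hA hX (differentiableAt_const u) d, hz]
    have : A z₀ ![X z₀, (0 : V)] = 0 :=
      (A z₀).map_coord_zero (m := ![X z₀, (0 : V)]) 1 rfl
    rw [this, add_zero]
  have h2 : fderiv ℝ (fun z => -Mu z ![u]) z₀ d = -(fderiv ℝ Mu z₀ d ![u]) := by
    have h : HasFDerivAt (fun z => -Mu z ![u])
        (-((ContinuousAlternatingMap.apply ℝ V ℝ ![u]).comp (fderiv ℝ Mu z₀))) z₀ :=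
      ((ContinuousAlternatingMap.apply ℝ V ℝ ![u]).hasFDerivAt.comp z₀ hMu.hasFDerivAt).neg
    rw [h.fderiv]
    rfl
  rw [← h1, hev.fderiv_eq, h2]

/-! ### The transported pairing and its derivative -/

section Pairing

variable {A : ℝ × V → V [⋀^Fin 2]→L[ℝ] ℝ} {Mu : ℝ × V → V [⋀^Fin 1]→L[ℝ] ℝ}
  {X : ℝ × V → V} {Q : ℝ × V → V} {s₀ : ℝ} {p₀ : V}

/-- **The transported pairing** `f(s) = A(s, Q(s, p₀)) [∂_p Q(s, p₀) v, ∂_p Q(s, p₀) w]`: with `A`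
the chart representative of `ω_s`, `Q` the flow `ψ_s` read in charts and `v, w` tangent vectors at
`p₀`, this is `(ψ_s^* ω_s)_{p₀}(v, w)`. [cite: McDuffSalamon2017, §3.2] -/
def trackPairing₂ (A : ℝ × V → V [⋀^Fin 2]→L[ℝ] ℝ) (Q : ℝ × V → V) (p₀ v w : V) (s : ℝ) : ℝ :=
  A (s, Q (s, p₀)) ![fderiv ℝ Q (s, p₀) (0, v), fderiv ℝ Q (s, p₀) (0, w)]

/-- **`f' = 0` for the transported pairing** (McDuff–Salamon 2017, §3.2; Cannas da
Silva–Guillemin–Woodward 2000, proof of Thm. 1 — in coordinates, on a pair of vectors).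
Hypotheses: `A`, `Q` are `C²` and `X`, `Mu` are `C¹` at the relevant points; the flow equation
`∂_s Q = X(s, Q)` near `(s₀, p₀)`; the Moser equation `A(X, u) = -Mu(u)` near `(s₀, Q(s₀, p₀))`;
`∂_s A = d Mu` and `dA = 0` at `(s₀, Q(s₀, p₀))`, written with Fréchet derivatives
(`dMu(a, b) = (D Mu · (0,a))(b) - (D Mu · (0,b))(a)`,
`dA(a, b, c) = (D A · (0,a))(b,c) - (D A · (0,b))(a,c) + (D A · (0,c))(a,b)`).
Conclusion: `f'(s₀) = 0`. [cite: McDuffSalamon2017, §3.2] -/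
theorem hasDerivAt_trackPairing₂ (v w : V)
    (hA : ContDiffAt ℝ 2 A (s₀, Q (s₀, p₀))) (hMu : ContDiffAt ℝ 1 Mu (s₀, Q (s₀, p₀)))
    (hX : ContDiffAt ℝ 1 X (s₀, Q (s₀, p₀))) (hQ : ContDiffAt ℝ 2 Q (s₀, p₀))
    (hflow : ∀ᶠ z in 𝓝 (s₀, p₀), fderiv ℝ Q z (1, 0) = X (z.1, Q z))
    (hmoser : ∀ᶠ z in 𝓝 (s₀, Q (s₀, p₀)), ∀ u, A z ![X z, u] = -Mu z ![u])
    (hdot : ∀ a b : V, fderiv ℝ A (s₀, Q (s₀, p₀)) (1, 0) ![a, b] =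
      fderiv ℝ Mu (s₀, Q (s₀, p₀)) (0, a) ![b] - fderiv ℝ Mu (s₀, Q (s₀, p₀)) (0, b) ![a])
    (hclosed : ∀ a b c : V, fderiv ℝ A (s₀, Q (s₀, p₀)) (0, a) ![b, c] -
      fderiv ℝ A (s₀, Q (s₀, p₀)) (0, b) ![a, c] + fderiv ℝ A (s₀, Q (s₀, p₀)) (0, c) ![a, b] = 0) :
    HasDerivAt (trackPairing₂ A Q p₀ v w) 0 s₀ := by
  set q₀ := Q (s₀, p₀) with hq₀
  set X₀ := X (s₀, q₀) with hX₀
  -- derivatives of `Q` and of `Φ = fderiv Q`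
  set Φ := fderiv ℝ Q with hΦ
  have hQd : HasFDerivAt Q (Φ (s₀, p₀)) (s₀, p₀) := (hQ.differentiableAt (by simp)).hasFDerivAt
  have hQ' : ContDiffAt ℝ (1 + 1) Q (s₀, p₀) := by rw [one_add_one_eq_two]; exact hQ
  have hΦd : HasFDerivAt Φ (fderiv ℝ Φ (s₀, p₀)) (s₀, p₀) :=
    (hQ'.fderiv_right_succ.differentiableAt (by simp)).hasFDerivAt
  have hc₁ : HasDerivAt (fun s : ℝ => ((s, p₀) : ℝ × V)) ((1 : ℝ), (0 : V)) s₀ :=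
    (hasDerivAt_id s₀).prodMk (hasDerivAt_const s₀ p₀)
  have hflow₀ : Φ (s₀, p₀) (1, 0) = X₀ := hflow.self_of_nhds
  have hq : HasDerivAt (fun s => Q (s, p₀)) X₀ s₀ := by
    have h := hQd.comp_hasDerivAt s₀ hc₁
    rwa [hflow₀] at h
  -- the transported vectors `a(s) = Φ (s, p₀) (0, v)`, `b(s) = Φ (s, p₀) (0, w)` and their
  -- derivatives (variational equation)
  have hvar : ∀ u : V, HasDerivAt (fun s => Φ (s, p₀) (0, u))
      (fderiv ℝ X (s₀, q₀) (0, Φ (s₀, p₀) (0, u))) s₀ := by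
    intro u
    have h1 : HasDerivAt (fun s => Φ (s, p₀)) (fderiv ℝ Φ (s₀, p₀) (1, 0)) s₀ :=
      hΦd.comp_hasDerivAt s₀ hc₁
    have h2 : HasDerivAt (fun s => Φ (s, p₀) (0, u)) (fderiv ℝ Φ (s₀, p₀) (1, 0) (0, u)) s₀ := by
      simpa using h1.clm_apply (hasDerivAt_const s₀ ((0 : ℝ), u))
    refine h2.congr_deriv ?_
    rw [(hQ.isSymmSndFDerivAt (by simp)).eq (1, 0) (0, u)]
    have h3 : fderiv ℝ Φ (s₀, p₀) (0, u) (1, 0) =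
        fderiv ℝ (fun z => Φ z (1, 0)) (s₀, p₀) (0, u) := by
      rw [fderiv_clm_apply hΦd.differentiableAt (differentiableAt_const _)]
      simp
    rw [h3, Filter.EventuallyEq.fderiv_eq (hflow : (fun z => Φ z (1, 0)) =ᶠ[𝓝 (s₀, p₀)]
      fun z => X (z.1, Q z))]
    have h4 : HasFDerivAt (fun z : ℝ × V => ((z.1, Q z) : ℝ × V))
        ((ContinuousLinearMap.fst ℝ ℝ V).prod (Φ (s₀, p₀))) (s₀, p₀) :=
      hasFDerivAt_fst.prodMk hQd
    have h5 : HasFDerivAt X (fderiv ℝ X (s₀, q₀)) (s₀, Q (s₀, p₀)) :=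
      (hX.differentiableAt (by simp)).hasFDerivAt
    have h45 : HasFDerivAt (fun z : ℝ × V => X (z.1, Q z))
        ((fderiv ℝ X (s₀, q₀)).comp ((ContinuousLinearMap.fst ℝ ℝ V).prod (Φ (s₀, p₀))))
        (s₀, p₀) := h5.comp (s₀, p₀) h4
    rw [h45.fderiv]
    rfl
  set a₀ := Φ (s₀, p₀) (0, v) with ha₀
  set b₀ := Φ (s₀, p₀) (0, w) with hb₀
  -- `𝒜(s) = A (s, Q (s, p₀))` and its derivative
  have hAd : HasFDerivAt A (fderiv ℝ A (s₀, q₀)) (s₀, q₀) :=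
    (hA.differentiableAt (by simp)).hasFDerivAt
  have h𝒜 : HasDerivAt (fun s => A (s, Q (s, p₀))) (fderiv ℝ A (s₀, q₀) (1, X₀)) s₀ :=
    hAd.comp_hasDerivAt s₀ ((hasDerivAt_id s₀).prodMk hq)
  -- the derivative of the pairing
  have hf : HasDerivAt (trackPairing₂ A Q p₀ v w)
      (fderiv ℝ A (s₀, q₀) (1, X₀) ![a₀, b₀] + A (s₀, q₀) ![fderiv ℝ X (s₀, q₀) (0, a₀), b₀] +
        A (s₀, q₀) ![a₀, fderiv ℝ X (s₀, q₀) (0, b₀)]) s₀ := by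
    have hd𝒜 := h𝒜.differentiableAt
    have hda := (hvar v).differentiableAt
    have hdb := (hvar w).differentiableAt
    have hdiff : DifferentiableAt ℝ (trackPairing₂ A Q p₀ v w) s₀ := by
      have h := hd𝒜.continuousAlternatingMap_apply
        (g := ![fun s => Φ (s, p₀) (0, v), fun s => Φ (s, p₀) (0, w)])
        (fun i => by
          fin_cases i
          · exact hda
          · exact hdb)
      have e1 : (fun s => A (s, Q (s, p₀)) fun i =>
          (![fun s => Φ (s, p₀) (0, v), fun s => Φ (s, p₀) (0, w)] : Fin 2 → ℝ → V) i s) =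
          trackPairing₂ A Q p₀ v w := by
        funext s; rw [← vec2_eq_fun]; rfl
      rwa [e1] at h
    have h1 : fderiv ℝ (fun s => A (s, Q (s, p₀))) s₀ 1 = fderiv ℝ A (s₀, q₀) (1, X₀) := by
      rw [fderiv_apply_one_eq_deriv]; exact h𝒜.deriv
    have h2 : fderiv ℝ (fun s => Φ (s, p₀) (0, v)) s₀ 1 = fderiv ℝ X (s₀, q₀) (0, a₀) := by
      rw [fderiv_apply_one_eq_deriv]; exact (hvar v).deriv
    have h3 : fderiv ℝ (fun s => Φ (s, p₀) (0, w)) s₀ 1 = fderiv ℝ X (s₀, q₀) (0, b₀) := by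
      rw [fderiv_apply_one_eq_deriv]; exact (hvar w).deriv
    have hderiv : deriv (trackPairing₂ A Q p₀ v w) s₀ =
        fderiv ℝ A (s₀, q₀) (1, X₀) ![a₀, b₀] + A (s₀, q₀) ![fderiv ℝ X (s₀, q₀) (0, a₀), b₀] +
          A (s₀, q₀) ![a₀, fderiv ℝ X (s₀, q₀) (0, b₀)] := by
      rw [← fderiv_apply_one_eq_deriv]
      show fderiv ℝ (fun s => A (s, Q (s, p₀)) ![Φ (s, p₀) (0, v), Φ (s, p₀) (0, w)]) s₀ 1 = _
      rw [fderiv_apply_vec2 (W := ℝ) hd𝒜 hda hdb 1, h1, h2, h3]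
    rw [← hderiv]
    exact hdiff.hasDerivAt
  refine hf.congr_deriv ?_
  -- algebra: Leibniz for the Moser equation, `∂_s A = dMu`, `dA = 0`
  have hKa := fderiv_moser_eq hAd.differentiableAt (hMu.differentiableAt (by simp))
    (hX.differentiableAt (by simp)) hmoser (0, a₀) b₀
  have hKb := fderiv_moser_eq hAd.differentiableAt (hMu.differentiableAt (by simp))
    (hX.differentiableAt (by simp)) hmoser (0, b₀) a₀
  have hlin : fderiv ℝ A (s₀, q₀) (1, X₀) ![a₀, b₀] =
      fderiv ℝ A (s₀, q₀) (1, 0) ![a₀, b₀] + fderiv ℝ A (s₀, q₀) (0, X₀) ![a₀, b₀] := by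
    rw [← ContinuousAlternatingMap.add_apply, ← map_add, Prod.mk_add_mk, add_zero, zero_add]
  have hsw : A (s₀, q₀) ![a₀, fderiv ℝ X (s₀, q₀) (0, b₀)] =
      -A (s₀, q₀) ![fderiv ℝ X (s₀, q₀) (0, b₀), a₀] := alt2_swap _ _ _
  have hd := hdot a₀ b₀
  have hc := hclosed X₀ a₀ b₀
  rw [hlin, hsw]
  linarith

end Pairing

end OrigamiMoser

end Literature.Geometry.Symplectic

end
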